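import Summits.BirchSwinnertonDyer.Rank1Residual.Additive.PadicLogImage
import Literature.NumberTheory.GaloisRepresentations.PadicAlgebraOfLocalField
import Literature.NumberTheory.EllipticCurves.PadicLogFiniteExtension
import Literature.NumberTheory.EllipticCurves.PadicFormalLogOrder
import Mathlib.NumberTheory.Padics.HeightOneSpectrum
import Mathlib.RingTheory.Trace.Basic
import HarnessLib

/-!
# Transport `ℚ_v ≅ ℚ_p` for the `(S5b)` cite fact: trace, points and the logarithm `log_ω`
# (route `KimAtThreeKolyvagin`, rung W2; cell `bsd-addord`, seat w2-c3 gen 8)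

HONEST FRAMING. Theorems only (no definition, no named fact, no `sorry`, no instance); nothing is
closed or booked; BSD is not proved by any of this. This file is PLUMBING for the consumer-side reading
of the Literature cite fact (S5b) `PAdicHodge.exists_smul_range_expStarCoord_iff_trace_log`
(Tate duality: the range of `exp*_ω` on `H¹(F, T_pW)` is the trace-dual of `log_ω(E(F))`, typed over a
GENERAL `p`-adic field `F ⊇ ℚ` with an `ℝ≥0`-valued valuation `w` and the Literature logarithm
`FormalGroupChart.padicLogPointFiniteExt w (W.baseChange F) p`) at the place `F = ℚ_v`
(`v.adicCompletion ℚ = Place.Completion (inr v)`), where the W2 packages (kim3's hK on crux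
`stmt-BirchSwinnertonDyer-19560`, w2-c3's (C1ₑₓ) / w2-c2's (C1_ω) on cruxes 19075 / 19076) state the
clause `hdual` in `ℚ_p`-currency with the Summits logarithm
`Additive.LocalLog.padicLog (W.baseChange ℚ_[p])`.

Along a `ℚ`-algebra isomorphism `e : ℚ_v ≃ₐ[ℚ] ℚ_[p]` (Mathlib's
`Rat.HeightOneSpectrum.adicCompletion.padicEquiv v`; the prime under `v` is `p`, `primesEquiv_eq`) and
for the valuation `w := ‖e ·‖` on `ℚ_v` (hypothesis `hw`):
* field level: `compatible_of_norm_algEquiv` (`w` is compatible with the valuative structure of `ℚ_v`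
  when `e` identifies the unit balls — `norm_padicEquiv_le_one_iff` for `padicEquiv`, from Mathlib's
  `padicEquiv_bijOn`), `algebraMap_eq_symm` (the canonical `ℚ_p`-structure of `ℚ_v`,
  `LocalField.adicCompletionPadicAlgebra`, has `algebraMap = e⁻¹` once `e⁻¹` is continuous — uniqueness
  of continuous `ℚ_p → ℚ_v`), **`trace_eq`: `Tr_{ℚ_v/ℚ_p} = e`**;
* `ℚ_p` side: **`padicLog_eq_padicLogPointFiniteExt`: the Summits logarithm `padicLog X` IS the
  Literature `padicLogPointFiniteExt ‖·‖ X p`** for a `p`-integral elliptic `X/ℚ_p` (both are the unique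
  homomorphism extending the limit logarithm on `E⁽²⁾(ℚ_p)`, `eq_padicLog_of_forall_mem`);
* `ℚ_v` side: integrality of `W ⊗ ℚ_v` for `w` (`isIntegral_baseChange_of_norm_algEquiv`, `W` globally
  minimal), completeness in the shape `hcomplete` and (SPEC) for the limit logarithm
  (`hcomplete_of_norm_algEquiv`, `limitLog_spec_of_norm_algEquiv`, transported from `ℚ_p`), every point
  has a positive multiple in the level (`index_nsmul_mem_level_of_norm_algEquiv`), and
  **`padicLogPointFiniteExt_map_algEquiv`: `log_{ℚ_p}(e P) = e (log_{ℚ_v} P)`** (the tree's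
  `padicLogPointFiniteExt_map_of_val_eq`); `exists_map_algEquiv_eq` (points over `ℚ_p` come from `ℚ_v`).

Consumer: `Theorems/KimAtThreeDeepUpperExpStarFacts` (`hdual` at the place from (S5b)).
References: Silverman, *AEC* (2009), IV.6.4, VII.2.2 [SilvermanAEC2009]; Serre, *Local Fields*, II §5
(rigidity of `ℚ_p`) [SerreLocalFields1979].
-/

set_option autoImplicit false
-- the Theorems namespace of a single-conjunct summit repeats the summit name by design (D-0017)
set_option linter.dupNamespace false

noncomputable section

open scoped NumberField NNReal WithZero Classical
open Field ValuativeRel IsDedekindDomain NumberField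
open Literature.NumberTheory.GaloisRepresentations
open Literature.NumberTheory.EllipticCurves WeierstrassCurve
open Literature.NumberTheory.EllipticCurves.FormalGroupChart
open Summit.BirchSwinnertonDyer.Rank1Residual.Additive.LocalLog
open Rat.HeightOneSpectrum

namespace Summit.BirchSwinnertonDyer.BirchSwinnertonDyer.Theorems.KimAtThreeDeepUpperExpStarTransport


variable (p : ℕ) [Fact p.Prime] (v : HeightOneSpectrum (𝓞 ℚ))

/-- The prime under a place `v ∋ p` of `ℚ` is `p`. [folklore] -/
theorem primesEquiv_eq (hv : ((p : ℕ) : 𝓞 ℚ) ∈ v.asIdeal) : ((primesEquiv v : Nat.Primes) : ℕ) = p := by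
  have hdvd : natGenerator v ∣ p := by
    rw [natGenerator_dvd_iff, ← map_natCast (Rat.IsIntegralClosure.intEquiv (𝓞 ℚ)) p]
    exact Ideal.mem_map_of_mem _ hv
  exact (Nat.prime_dvd_prime_iff_eq (prime_natGenerator v) Fact.out).mp hdvd

section Transport

/-! Field-level transport along a `ℚ`-algebra isomorphism `e : ℚ_v ≃ₐ[ℚ] ℚ_[p]` whose inverse is
continuous and which maps `𝒪_v` onto `ℤ_p` (both hold for Mathlib's `padicEquiv`). -/

variable (e : v.adicCompletion ℚ ≃ₐ[ℚ] ℚ_[p])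

variable (w : Valuation (v.adicCompletion ℚ) ℝ≥0) (hw : ∀ x, w x = ‖e x‖₊)

include hw in
/-- If `e` identifies the unit balls, the valuation `w = ‖e ·‖` is compatible with the valuative
structure of `ℚ_v` (it is equivalent to `Valued.v`: same unit ball). [folklore] -/
theorem compatible_of_norm_algEquiv
    (hball : ∀ x : v.adicCompletion ℚ, ‖e x‖ ≤ 1 ↔ x ∈ v.adicCompletionIntegers ℚ) :
    w.Compatible := by
  have hequiv : w.IsEquiv (Valued.v : Valuation (v.adicCompletion ℚ) ℤᵐ⁰) := by
    rw [Valuation.isEquiv_iff_val_le_one]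
    intro x
    rw [hw, ← NNReal.coe_le_coe, coe_nnnorm, NNReal.coe_one, hball,
      HeightOneSpectrum.mem_adicCompletionIntegers]
  refine ⟨fun x y => ?_⟩
  rw [Valuation.Compatible.vle_iff_le (v := (Valued.v : Valuation (v.adicCompletion ℚ) ℤᵐ⁰))]
  exact (hequiv x y).symm

/-- `algebraMap ℚ_[p] ℚ_v` for the canonical `ℚ_p`-algebra structure is `e⁻¹` when `e⁻¹` is
continuous (uniqueness of continuous `ℚ_p → ℚ_v`). [folklore] -/
theorem algebraMap_eq_symm (hv : ((p : ℕ) : 𝓞 ℚ) ∈ v.asIdeal) (hcont : Continuous e.symm)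
    (y : ℚ_[p]) :
    (letI := LocalField.adicCompletionPadicAlgebra v p hv; algebraMap ℚ_[p] (v.adicCompletion ℚ) y) =
      e.symm y := by
  have h := LocalField.eq_algebraMap_adicCompletionPadicAlgebra v p hv
    (e.symm : ℚ_[p] →+* v.adicCompletion ℚ) hcont
  exact (RingHom.congr_fun h y).symm

/-- **The trace `ℚ_v → ℚ_p` is `e`**: `e` is a `ℚ_p`-algebra isomorphism for the canonical
`ℚ_p`-structure on `ℚ_v` (`algebraMap_eq_symm`), and the trace of `ℚ_p` over itself is the identity.
[folklore] -/
theorem trace_eq (hv : ((p : ℕ) : 𝓞 ℚ) ∈ v.asIdeal) (hcont : Continuous e.symm)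
    (x : v.adicCompletion ℚ) :
    (letI := LocalField.adicCompletionPadicAlgebra v p hv;
      Algebra.trace ℚ_[p] (v.adicCompletion ℚ) x) = e x := by
  letI := LocalField.adicCompletionPadicAlgebra v p hv
  let e' : v.adicCompletion ℚ ≃ₐ[ℚ_[p]] ℚ_[p] :=
    AlgEquiv.ofRingEquiv (f := (e : v.adicCompletion ℚ ≃+* ℚ_[p])) fun y => by
      change e (algebraMap ℚ_[p] (v.adicCompletion ℚ) y) = y
      rw [algebraMap_eq_symm p v e hv hcont, AlgEquiv.apply_symm_apply]
  have h := Algebra.trace_eq_of_algEquiv e' x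
  rw [Algebra.trace_self_apply] at h
  exact h.symm

end Transport

/-- Mathlib's `padicEquiv` identifies the unit balls. [folklore] -/
theorem norm_padicEquiv_le_one_iff (x : v.adicCompletion ℚ) :
    haveI := Fact.mk (primesEquiv v).2
    ‖(adicCompletion.padicEquiv (R := 𝓞 ℚ) v) x‖ ≤ 1 ↔ x ∈ v.adicCompletionIntegers ℚ := by
  haveI := Fact.mk (primesEquiv v).2
  have hbij := adicCompletion.padicEquiv_bijOn (R := 𝓞 ℚ) v
  constructor
  · intro h
    obtain ⟨y, hy, hyx⟩ := hbij.2.2 (show _ ∈ PadicInt.subring _ from h)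
    rwa [← (adicCompletion.padicEquiv (R := 𝓞 ℚ) v).injective hyx]
  · intro h
    exact (hbij.1 h : _ ∈ PadicInt.subring _)


open Literature.NumberTheory.EllipticCurves.FormalGroupChart
open Summit.BirchSwinnertonDyer.Rank1Residual.Additive.LocalLog

section PadicSide

variable {p : ℕ} [Fact p.Prime] (X : WeierstrassCurve ℚ_[p]) [X.IsIntegral ℤ_[p]] [X.IsElliptic]
  [hV' : X.IsIntegral (NormedField.valuation (K := ℚ_[p])).integer]

/-- `‖p‖ < 1` in `ℚ_p`. [folklore] -/
theorem valuation_natCast_lt_one_padic : NormedField.valuation ((p : ℕ) : ℚ_[p]) < 1 := by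
  rw [NormedField.valuation_apply, ← NNReal.coe_lt_coe, coe_nnnorm, NNReal.coe_one, Padic.norm_p]
  exact inv_lt_one_of_one_lt₀ (by exact_mod_cast (Fact.out : p.Prime).one_lt)

/-- A point of `E⁽²⁾(ℚ_p)` lies in the level `E⁽ᵖ⁾ = E₁` of the chart calculus. [folklore] -/
theorem mem_level_of_mem_formalFiltration_two {P : X.toAffine.Point} (hP : P ∈ X.formalFiltration 2) :
    P ∈ level NormedField.valuation X (NormedField.valuation ((p : ℕ) : ℚ_[p])) := by
  rw [level_padic_eq_kernel, mem_kernel_iff_isInReductionKernel]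
  exact hP.1

/-- Every point of `E(ℚ_p)` has the positive multiple `N • P`, `N = [E(ℚ_p) : E⁽²⁾(ℚ_p)]`, in the
level. [folklore] -/
theorem index_nsmul_mem_level (P : X.toAffine.Point) :
    (X.formalFiltration 2).index • P ∈
      level NormedField.valuation X (NormedField.valuation ((p : ℕ) : ℚ_[p])) :=
  mem_level_of_mem_formalFiltration_two X ((X.formalFiltration 2).nsmul_index_mem P)

/-- **The Summits-side logarithm `padicLog` IS the Literature logarithm `padicLogPointFiniteExt`
over `ℚ_p`** (both are the unique homomorphism extending the limit logarithm on `E⁽²⁾(ℚ_p)`).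
[folklore] -/
theorem padicLog_eq_padicLogPointFiniteExt (Q : X.toAffine.Point) :
    padicLog X Q = padicLogPointFiniteExt NormedField.valuation X p Q := by
  have hp0 := natCast_p_ne_zero (p := p)
  have hp1 := valuation_natCast_lt_one_padic (p := p)
  have hN : 0 < (X.formalFiltration 2).index :=
    Nat.pos_of_ne_zero (index_formalFiltration_two_ne_zero X)
  let f : X.toAffine.Point →+ ℚ_[p] :=
    { toFun := fun P => padicLogPointFiniteExt NormedField.valuation X p P
      map_zero' := padicLogPointFiniteExt_zero hp0 hp1 (limitLog_spec_of_completeSpace hp0 hp1)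
      map_add' := fun P P' => padicLogPointFiniteExt_add_of_completeSpace hp0 hp1 hN
        (index_nsmul_mem_level X P) hN (index_nsmul_mem_level X P') }
  have hf : ∀ P ∈ X.formalFiltration 2, f P = X.padicLimitLog P := by
    intro P hP
    change padicLogPointFiniteExt NormedField.valuation X p P = _
    have hPk : P ∈ FormalGroupChart.kernel NormedField.valuation X :=
      (mem_kernel_iff_isInReductionKernel X P).mpr hP.1
    rw [padicLogPointFiniteExt_eq_padicLimitLog_div_of_mem_kernel hPk,
      X.padicLimitLog_nsmul_of_mem le_rfl hP p, mul_div_cancel_left₀ _ hp0]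
  have key := eq_padicLog_of_forall_mem X f hf
  exact (DFunLike.congr_fun key Q).symm

end PadicSide

section AdicSide

variable {p : ℕ} [Fact p.Prime] {v : HeightOneSpectrum (𝓞 ℚ)}
  (e : v.adicCompletion ℚ ≃ₐ[ℚ] ℚ_[p]) {w : Valuation (v.adicCompletion ℚ) ℝ≥0}
  (hw : ∀ x, w x = ‖e x‖₊) (W : WeierstrassCurve ℚ)

/-- `e` commutes with the structure maps from `ℚ` (it is a `ℚ`-algebra map). [folklore] -/
theorem algEquiv_algebraMap (q : ℚ) : e (algebraMap ℚ (v.adicCompletion ℚ) q) = (q : ℚ_[p]) :=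
  e.commutes q

/-- `e p = p`. [folklore] -/
theorem algEquiv_natCast (n : ℕ) : e (n : v.adicCompletion ℚ) = (n : ℚ_[p]) := map_natCast e n

include hw in
/-- **A globally minimal `W/ℚ` is integral over `ℚ_v` for `w = ‖e ·‖`** (its coefficients are rational
integers, of `p`-adic norm `≤ 1`). [folklore] -/
theorem isIntegral_baseChange_of_norm_algEquiv [W.IsGloballyMinimal] :
    (W.baseChange (v.adicCompletion ℚ)).IsIntegral w.integer := by
  obtain ⟨W₀, hW₀⟩ := (inferInstance : W.IsIntegral (𝓞 ℚ)).integral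
  have hmem : ∀ r : 𝓞 ℚ, algebraMap ℚ (v.adicCompletion ℚ) (algebraMap (𝓞 ℚ) ℚ r) ∈
      w.integer := fun r => by
    change w _ ≤ 1
    rw [hw, algEquiv_algebraMap, ← Rat.ringOfIntegersEquiv_apply_coe, ← NNReal.coe_le_coe, coe_nnnorm,
      NNReal.coe_one]
    exact_mod_cast Padic.norm_int_le_one _
  refine WeierstrassCurve.isIntegral_of_exists_lift _
    ⟨⟨_, hmem W₀.a₁⟩, ?_⟩ ⟨⟨_, hmem W₀.a₂⟩, ?_⟩ ⟨⟨_, hmem W₀.a₃⟩, ?_⟩ ⟨⟨_, hmem W₀.a₄⟩, ?_⟩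
    ⟨⟨_, hmem W₀.a₆⟩, ?_⟩
  all_goals rw [hW₀]; rfl

/-- **Completeness in the shape `hcomplete`** for `ℚ_p`: a sequence with
`‖x_{r+1} − x_r‖ ≤ ‖p‖^{r+1}` has a limit `y` with `‖y − x_r‖ ≤ ‖p‖^{r+1}`. [folklore] -/
theorem exists_forall_norm_sub_le_pow_padic (x : ℕ → ℚ_[p])
    (hx : ∀ r, ‖x (r + 1) - x r‖ ≤ ‖(p : ℚ_[p])‖ ^ (r + 1)) :
    ∃ y : ℚ_[p], ∀ r, ‖y - x r‖ ≤ ‖(p : ℚ_[p])‖ ^ (r + 1) := by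
  set ρ : ℝ := ‖(p : ℚ_[p])‖ with hρ
  have hρ0 : 0 ≤ ρ := norm_nonneg _
  have hρ1 : ρ < 1 := by
    rw [hρ, Padic.norm_p]; exact inv_lt_one_of_one_lt₀ (by exact_mod_cast (Fact.out : p.Prime).one_lt)
  have hu : ∀ n, dist (x n) (x (n + 1)) ≤ ρ * ρ ^ n := fun n ↦ by
    rw [dist_comm, dist_eq_norm, ← pow_succ']; exact hx n
  have hcau : CauchySeq x := cauchySeq_of_le_geometric ρ ρ hρ1 hu
  obtain ⟨y, hy⟩ := cauchySeq_tendsto_of_complete hcau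
  refine ⟨y, fun r ↦ ?_⟩
  have htel : ∀ k, ‖x (k + r) - x r‖ ≤ ρ ^ (r + 1) := by
    intro k
    induction k with
    | zero => simp only [zero_add, sub_self, norm_zero]; positivity
    | succ k ih =>
      have h1 : ‖x (k + r + 1) - x (k + r)‖ ≤ ρ ^ (r + 1) :=
        (hx (k + r)).trans (pow_le_pow_of_le_one hρ0 hρ1.le (by omega))
      have ek : k + 1 + r = k + r + 1 := by omega
      calc ‖x (k + 1 + r) - x r‖ = dist (x (k + r + 1)) (x r) := by rw [dist_eq_norm, ek]
        _ ≤ max (dist (x (k + r + 1)) (x (k + r))) (dist (x (k + r)) (x r)) := dist_triangle_max _ _ _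
        _ ≤ ρ ^ (r + 1) := by rw [dist_eq_norm, dist_eq_norm]; exact max_le h1 ih
  have hlim : Filter.Tendsto (fun k ↦ ‖x (k + r) - x r‖) Filter.atTop (nhds ‖y - x r‖) :=
    (((Filter.tendsto_add_atTop_iff_nat r).mpr hy).sub_const (x r)).norm
  exact le_of_tendsto' hlim fun k ↦ htel k

include hw in
/-- **Completeness of `ℚ_v` in the shape `hcomplete` for `w = ‖e ·‖`** (transport along `e` of the
completeness of `ℚ_p`). [folklore] -/
theorem hcomplete_of_norm_algEquiv (x : ℕ → v.adicCompletion ℚ)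
    (hx : ∀ r, w (x (r + 1) - x r) ≤ w (p : v.adicCompletion ℚ) ^ (r + 1)) :
    ∃ y : v.adicCompletion ℚ, ∀ r, w (y - x r) ≤ w (p : v.adicCompletion ℚ) ^ (r + 1) := by
  have hx' : ∀ r, ‖e (x (r + 1)) - e (x r)‖ ≤ ‖(p : ℚ_[p])‖ ^ (r + 1) := fun r => by
    have h := hx r
    rw [hw, hw, map_sub, algEquiv_natCast, ← NNReal.coe_le_coe, coe_nnnorm,
      NNReal.coe_pow, coe_nnnorm] at h
    exact h
  obtain ⟨y', hy'⟩ := exists_forall_norm_sub_le_pow_padic (fun r => e (x r)) hx'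
  refine ⟨e.symm y', fun r => ?_⟩
  rw [hw, hw, map_sub, AlgEquiv.apply_symm_apply, algEquiv_natCast,
    ← NNReal.coe_le_coe, coe_nnnorm, NNReal.coe_pow, coe_nnnorm]
  exact hy' r

variable [hK : (W.baseChange (v.adicCompletion ℚ)).IsIntegral w.integer]
  [hK' : (W.baseChange ℚ_[p]).IsIntegral (NormedField.valuation (K := ℚ_[p])).integer]
  [(W.baseChange ℚ_[p]).IsIntegral ℤ_[p]] [W.IsElliptic]

omit hK' [(W.baseChange ℚ_[p]).IsIntegral ℤ_[p]] [W.IsElliptic] in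
include hw in
/-- **(SPEC) for the limit logarithm of `W ⊗ ℚ_v` in the valuation `w = ‖e ·‖`.** [folklore] -/
theorem limitLog_spec_of_norm_algEquiv :
    ∀ Q ∈ level w (W.baseChange (v.adicCompletion ℚ)) (w (p : v.adicCompletion ℚ)), ∀ r : ℕ,
      w (limitLog w (W.baseChange (v.adicCompletion ℚ)) p Q -
          ((p ^ r) • Q).zCoord / (p : v.adicCompletion ℚ) ^ r) ≤ w (p : v.adicCompletion ℚ) ^ (r + 1) := by
  have hp0 : (p : v.adicCompletion ℚ) ≠ 0 := by
    rw [← map_natCast (algebraMap ℚ (v.adicCompletion ℚ)) p]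
    exact (map_ne_zero _).mpr (Nat.cast_ne_zero.mpr (Fact.out : p.Prime).ne_zero)
  exact limitLog_spec hp0 (hcomplete_of_norm_algEquiv e hw)

include hw in
/-- `w p < 1`. [folklore] -/
theorem natCast_lt_one_of_norm_algEquiv : w (p : v.adicCompletion ℚ) < 1 := by
  rw [hw, algEquiv_natCast]
  exact valuation_natCast_lt_one_padic (p := p)

include hw in
/-- Every point of `E(ℚ_v)` has a positive multiple in the level (transport of
`index_nsmul_mem_level` along `e`). [folklore] -/
theorem index_nsmul_mem_level_of_norm_algEquiv (P : (W.baseChange (v.adicCompletion ℚ)).toAffine.Point) :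
    ((W.baseChange ℚ_[p]).formalFiltration 2).index • P ∈
      level w (W.baseChange (v.adicCompletion ℚ)) (w (p : v.adicCompletion ℚ)) := by
  have h := index_nsmul_mem_level (W.baseChange ℚ_[p])
    (WeierstrassCurve.Affine.Point.map (e : v.adicCompletion ℚ →ₐ[ℚ] ℚ_[p]) P)
  rw [← map_nsmul] at h
  have hι : ∀ x, NormedField.valuation ((e : v.adicCompletion ℚ →ₐ[ℚ] ℚ_[p]) x) = w x :=
    fun x => (hw x).symm
  refine ⟨(map_mem_kernel_iff_of_val_eq (X := W) hι _).mp h.1, ?_⟩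
  have h2 := h.2
  rw [zCoord_map, hι] at h2
  have hp : w (p : v.adicCompletion ℚ) = NormedField.valuation (p : ℚ_[p]) := by
    rw [hw, algEquiv_natCast]; rfl
  rw [hp]
  exact h2

include hw in
/-- **Transport of the logarithm along `e`: `log_{ℚ_p}(e P) = e (log_{ℚ_v} P)`.** [folklore] -/
theorem padicLogPointFiniteExt_map_algEquiv (P : (W.baseChange (v.adicCompletion ℚ)).toAffine.Point) :
    padicLogPointFiniteExt NormedField.valuation (W.baseChange ℚ_[p]) p
        (WeierstrassCurve.Affine.Point.map (e : v.adicCompletion ℚ →ₐ[ℚ] ℚ_[p]) P) =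
      e (padicLogPointFiniteExt w (W.baseChange (v.adicCompletion ℚ)) p P) := by
  have hp0 : (p : v.adicCompletion ℚ) ≠ 0 := by
    rw [← map_natCast (algebraMap ℚ (v.adicCompletion ℚ)) p]
    exact (map_ne_zero _).mpr (Nat.cast_ne_zero.mpr (Fact.out : p.Prime).ne_zero)
  have hN : 0 < ((W.baseChange ℚ_[p]).formalFiltration 2).index :=
    Nat.pos_of_ne_zero (index_formalFiltration_two_ne_zero (W.baseChange ℚ_[p]))
  exact padicLogPointFiniteExt_map_of_val_eq (X := W) hp0 (natCast_lt_one_of_norm_algEquiv e hw)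
    (limitLog_spec_of_norm_algEquiv e hw W)
    (limitLog_spec_of_completeSpace natCast_p_ne_zero valuation_natCast_lt_one_padic)
    (ι := (e : v.adicCompletion ℚ →ₐ[ℚ] ℚ_[p])) (fun x => (hw x).symm) hN
    (index_nsmul_mem_level_of_norm_algEquiv e hw W P)

omit hK hK' [(W.baseChange ℚ_[p]).IsIntegral ℤ_[p]] [W.IsElliptic] in
/-- Points transport: every point over `ℚ_p` comes from one over `ℚ_v`. [folklore] -/
theorem exists_map_algEquiv_eq (Q : (W.baseChange ℚ_[p]).toAffine.Point) :
    ∃ P : (W.baseChange (v.adicCompletion ℚ)).toAffine.Point,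
      WeierstrassCurve.Affine.Point.map (e : v.adicCompletion ℚ →ₐ[ℚ] ℚ_[p]) P = Q := by
  refine ⟨WeierstrassCurve.Affine.Point.map (e.symm : ℚ_[p] →ₐ[ℚ] v.adicCompletion ℚ) Q, ?_⟩
  rw [WeierstrassCurve.Affine.Point.map_map, AlgEquiv.comp_symm]
  cases Q <;> rfl

end AdicSide


end Summit.BirchSwinnertonDyer.BirchSwinnertonDyer.Theorems.KimAtThreeDeepUpperExpStarTransport

end
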